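import Summits.HodgeConjecture.CorCM.Census.SexticDecicWeilPartsBalanced
import HarnessLib

/-!
# `E × T × B` over a sextic and a decic CM field sharing `k`: EXTRACTION of a part from every non-empty balanced configuration, and
# the INDUCTION PRINCIPLE for balanced configurations (any number of copies)

COR-CM (cell `pub-hodgecm2`), seat b30 gen 27 (2026-08-23); count-neutral own lane SEXTIC-DECIC, sequel of
`Census/SexticDecicWeil{,Defect,Parts,PartsBalanced}.lean`; the degree-`(6,10)` twin of gen 26ʼs `Census/SexticOcticWeilExtraction.lean`.
Theorems of the finite model only; no definition, no named fact, no geometry, no `sorry`, no `decide`.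

EXTRACTION (greedy, from the defect law `d₁ ≡ t₁`, `d₃ ≡ t₃`, `e = t₁ + t₃` under a realised set `R` that is rotation-stable on the
decic pairs (`hrot`) and transitive on the sextic pairs (`ht`)):
* `t₁ > 0 > t₃` (resp. `t₁ < 0 < t₃`): an EIGHT part (`T⁺B⁻`, resp. `T⁻B⁺`);
* otherwise all non-zero defects share a sign: `t₁ ≠ 0` gives a FOUR part (`|e| = |t₁| + |t₃| ≥ 1`), else `t₃ ≠ 0` a SIX part
  (`|e| = |t₃| ≥ 1`), else every count is conjugation-invariant and a non-empty configuration has a PAIR part.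
Hence **`modelBalancedSD_induction`**: a property of configurations that holds for `∅` and passes from `S` to `G ∪ S` for a disjoint
pair / four / six / eight part `G` holds for every `R`-balanced configuration.
[cite: Milne2020HodgeClassesAV, 1.2 (a) and Thm. 1] [cite: MoonenZarhin1995Duke, Thm. 2.4] [cite: GaoUllmo2025, Thm 3.1]

## References
* [Milne2020HodgeClassesAV] J. S. Milne, arXiv:2010.08857, 1.2 (a), Thm. 1.  [MoonenZarhin1995Duke] B. Moonen, Yu. Zarhin, Duke
  Math. J. 77 (1995), Thm. 2.4.  [GaoUllmo2025] Z. Gao, E. Ullmo, J. Inst. Math. Jussieu 25 (2025), Thm 3.1.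
-/

namespace Summit.HodgeConjecture.CorCM.Census.SexticDecicWeil

open Finset

variable {α : Type*} {R : Finset (Equiv.Perm (Fin 3) × Equiv.Perm (Fin 5))} {v : α → PtSD}

/-! ### Membership and non-emptiness of the composite parts -/

/-- Every point of a four part lies over `inl b` or over a label `(1, a, b)`. [folklore] -/
theorem IsFourPartSD.mem_cases [DecidableEq α] {b : Bool} {G : Finset α} (hG : IsFourPartSD v b G) {x : α} (hx : x ∈ G) :
    v x = Sum.inl b ∨ ∃ a : Fin 3, v x = Sum.inr (Sum.inl (a, b)) := by
  obtain ⟨x₀, G₁, -, rfl, hvx₀, hG₁⟩ := hG.exists_split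
  rcases Finset.mem_insert.1 hx with rfl | hx
  · exact Or.inl hvx₀
  · exact Or.inr (hG₁.exists_eq hx)

/-- Every point of a six part lies over `inl b` or over a label `(2, a, b)`. [folklore] -/
theorem IsSixPartSD.mem_cases [DecidableEq α] {b : Bool} {G : Finset α} (hG : IsSixPartSD v b G) {x : α} (hx : x ∈ G) :
    v x = Sum.inl b ∨ ∃ a : Fin 5, v x = Sum.inr (Sum.inr (a, b)) := by
  obtain ⟨x₀, G₁, -, rfl, hvx₀, hG₁⟩ := hG.exists_split
  rcases Finset.mem_insert.1 hx with rfl | hx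
  · exact Or.inl hvx₀
  · exact Or.inr (hG₁.exists_eq hx)

/-- Every point of an eight part lies over a label `(1, a, b)` or over a label `(2, a, ¬b)`. [folklore] -/
theorem IsEightPartSD.mem_cases [DecidableEq α] {b : Bool} {G : Finset α} (hG : IsEightPartSD v b G) {x : α} (hx : x ∈ G) :
    (∃ a : Fin 3, v x = Sum.inr (Sum.inl (a, b))) ∨ ∃ a : Fin 5, v x = Sum.inr (Sum.inr (a, !b)) := by
  obtain ⟨G₁, G₂, -, rfl, hG₁, hG₂⟩ := hG.exists_split
  rcases Finset.mem_union.1 hx with hx | hx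
  · exact Or.inl (hG₁.exists_eq hx)
  · exact Or.inr (hG₂.exists_eq hx)

/-- A four part is non-empty. [folklore] -/
theorem IsFourPartSD.nonempty {b : Bool} {G : Finset α} (hG : IsFourPartSD v b G) : G.Nonempty := by
  rw [← Finset.card_pos, hG.1]; norm_num

/-- A six part is non-empty. [folklore] -/
theorem IsSixPartSD.nonempty {b : Bool} {G : Finset α} (hG : IsSixPartSD v b G) : G.Nonempty := by
  rw [← Finset.card_pos, hG.1]; norm_num

/-- An eight part is non-empty. [folklore] -/
theorem IsEightPartSD.nonempty {b : Bool} {G : Finset α} (hG : IsEightPartSD v b G) : G.Nonempty := by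
  rw [← Finset.card_pos, hG.1]; norm_num

/-! ### The composite parts from the counts -/

/-- Filters of a union with a three part over labels off the three part. [folklore] -/
private theorem card_filter_union_three [DecidableEq α] {b : Bool} {W S : Finset α} (hW : IsThreePartSD v b W) {z : PtSD}
    (hz : ∀ a : Fin 3, z ≠ Sum.inr (Sum.inl (a, b))) :
    ((S ∪ W).filter fun x => v x = z).card = (S.filter fun x => v x = z).card := by
  rw [Finset.filter_union, Finset.filter_false_of_mem (s := W) fun x hx h => ?_, Finset.union_empty]
  obtain ⟨a, ha⟩ := hW.exists_eq hx
  exact hz a (h.symm.trans ha)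

/-- Filters of a union with a five part over labels off the five part. [folklore] -/
private theorem card_filter_union_five [DecidableEq α] {b : Bool} {W S : Finset α} (hW : IsFivePartSD v b W) {z : PtSD}
    (hz : ∀ a : Fin 5, z ≠ Sum.inr (Sum.inr (a, b))) :
    ((S ∪ W).filter fun x => v x = z).card = (S.filter fun x => v x = z).card := by
  rw [Finset.filter_union, Finset.filter_false_of_mem (s := W) fun x hx h => ?_, Finset.union_empty]
  obtain ⟨a, ha⟩ := hW.exists_eq hx
  exact hz a (h.symm.trans ha)

/-- `n` points of `T` over the label `y`, given `n ≤ N(y)`. [folklore] -/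
private theorem exists_fibre_subset [DecidableEq α] {T : Finset α} (y : PtSD) {n : ℕ} (hn : n ≤ (T.filter fun x => v x = y).card) :
    ∃ C ⊆ T, C.card = n ∧ ∀ x ∈ C, v x = y := by
  obtain ⟨C, hC, hcard⟩ := Finset.exists_subset_card_eq hn
  exact ⟨C, fun x hx => (Finset.mem_filter.1 (hC hx)).1, hcard, fun x hx => (Finset.mem_filter.1 (hC hx)).2⟩

/-- A four part inside `T` from the counts. [folklore] -/
theorem exists_fourPartSD_of_counts [DecidableEq α] {T : Finset α} (b : Bool) (hE : 0 < (T.filter fun x => v x = Sum.inl b).card)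
    (hT : ∀ a : Fin 3, 0 < (T.filter fun x => v x = Sum.inr (Sum.inl (a, b))).card) : ∃ G ⊆ T, IsFourPartSD v b G := by
  obtain ⟨C, hCT, hC, hvC⟩ := exists_fibre_subset (v := v) (Sum.inl b) (Nat.one_le_of_lt hE)
  obtain ⟨W, hWT, hW⟩ := exists_threePartSD_of_counts (v := v) (T := T) b hT
  have hCW : Disjoint C W := by
    rw [Finset.disjoint_left]
    intro x hxC hxW
    obtain ⟨a, ha⟩ := hW.exists_eq hxW
    rw [hvC x hxC] at ha; exact Sum.inl_ne_inr ha
  refine ⟨C ∪ W, Finset.union_subset hCT hWT, ?_, ?_, fun a => ?_⟩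
  · rw [Finset.card_union_of_disjoint hCW, hC, hW.1]
  · rw [card_filter_union_three (S := C) hW fun a => Sum.inl_ne_inr, Finset.filter_true_of_mem hvC, hC]
  · rw [Finset.filter_union, Finset.filter_false_of_mem (s := C) fun x hx h => ?_, Finset.empty_union, hW.2 a]
    rw [hvC x hx] at h; exact Sum.inl_ne_inr h

/-- A six part inside `T` from the counts. [folklore] -/
theorem exists_sixPartSD_of_counts [DecidableEq α] {T : Finset α} (b : Bool) (hE : 0 < (T.filter fun x => v x = Sum.inl b).card)
    (hB : ∀ a : Fin 5, 0 < (T.filter fun x => v x = Sum.inr (Sum.inr (a, b))).card) : ∃ G ⊆ T, IsSixPartSD v b G := by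
  obtain ⟨C, hCT, hC, hvC⟩ := exists_fibre_subset (v := v) (Sum.inl b) (Nat.one_le_of_lt hE)
  obtain ⟨W, hWT, hW⟩ := exists_fivePartSD_of_counts (v := v) (T := T) b hB
  have hCW : Disjoint C W := by
    rw [Finset.disjoint_left]
    intro x hxC hxW
    obtain ⟨a, ha⟩ := hW.exists_eq hxW
    rw [hvC x hxC] at ha; exact Sum.inl_ne_inr ha
  refine ⟨C ∪ W, Finset.union_subset hCT hWT, ?_, ?_, fun a => ?_⟩
  · rw [Finset.card_union_of_disjoint hCW, hC, hW.1]
  · rw [card_filter_union_five (S := C) hW fun a => Sum.inl_ne_inr, Finset.filter_true_of_mem hvC, hC]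
  · rw [Finset.filter_union, Finset.filter_false_of_mem (s := C) fun x hx h => ?_, Finset.empty_union, hW.2 a]
    rw [hvC x hx] at h; exact Sum.inl_ne_inr h

/-- An eight part inside `T` from the counts. [folklore] -/
theorem exists_eightPartSD_of_counts [DecidableEq α] {T : Finset α} (b : Bool)
    (hT : ∀ a : Fin 3, 0 < (T.filter fun x => v x = Sum.inr (Sum.inl (a, b))).card)
    (hB : ∀ a : Fin 5, 0 < (T.filter fun x => v x = Sum.inr (Sum.inr (a, !b))).card) : ∃ G ⊆ T, IsEightPartSD v b G := by
  obtain ⟨W₁, hW₁T, hW₁⟩ := exists_threePartSD_of_counts (v := v) (T := T) b hT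
  obtain ⟨W₂, hW₂T, hW₂⟩ := exists_fivePartSD_of_counts (v := v) (T := T) (!b) hB
  have hW₁₂ : Disjoint W₁ W₂ := by
    rw [Finset.disjoint_left]
    intro x hx1 hx2
    obtain ⟨a, ha⟩ := hW₁.exists_eq hx1
    obtain ⟨a', ha'⟩ := hW₂.exists_eq hx2
    have := ha.symm.trans ha'
    simp at this
  refine ⟨W₁ ∪ W₂, Finset.union_subset hW₁T hW₂T, ?_, fun a => ?_, fun a => ?_⟩
  · rw [Finset.card_union_of_disjoint hW₁₂, hW₁.1, hW₂.1]
  · have hq := card_filter_union_five (S := W₁) hW₂ (z := Sum.inr (Sum.inl (a, b))) fun a' h => by simp at h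
    rw [hq, hW₁.2 a]
  · rw [Finset.filter_union, Finset.filter_false_of_mem (s := W₁) fun x hx h => ?_, Finset.empty_union, hW₂.2 a]
    obtain ⟨a', ha'⟩ := hW₁.exists_eq hx
    have := h.symm.trans ha'
    simp at this

/-! ### Extraction and induction -/

section Extraction

variable (g : Equiv.Perm (Fin 5)) (hrot : ∀ π ∈ R, (π.1, π.2 * (g * finRotate 5 * g⁻¹)) ∈ R) (ht : ∀ x : Fin 3, ∃ π ∈ R, π.1 x = 0)

include g hrot ht in
/-- **EXTRACTION.**  Under a rotation-stable, sextic-transitive `R`, a non-empty `R`-balanced configuration contains a pair, four, six or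
eight part (module docstring: greedy on the signs of the defects `t₁`, `t₃`, `e = t₁ + t₃`).
[cite: Milne2020HodgeClassesAV, 1.2 (a) and Thm. 1] [cite: MoonenZarhin1995Duke, Thm. 2.4] -/
theorem exists_part_of_modelBalancedSD [DecidableEq α] {T : Finset α} (hT : ModelBalancedSD R v T) (hne : T.Nonempty) :
    ∃ G ⊆ T, IsPairPartSD v G ∨ (∃ b, IsFourPartSD v b G) ∨ (∃ b, IsSixPartSD v b G) ∨ ∃ b, IsEightPartSD v b G := by
  obtain ⟨t₁, t₃, h₁, h₃, hE⟩ := exists_defectSD_of_modelBalancedSD g hrot ht hT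
  -- opposite strict signs: an eight part
  by_cases hA : 0 < t₁ ∧ t₃ < 0
  · obtain ⟨ht₁, ht₃⟩ := hA
    obtain ⟨G, hG, h⟩ := exists_eightPartSD_of_counts (v := v) (T := T) true
      (fun a => by have h := h₁ a; omega) (fun a => by have h := h₃ a; rw [Bool.not_true]; omega)
    exact ⟨G, hG, Or.inr (Or.inr (Or.inr ⟨true, h⟩))⟩
  by_cases hB : t₁ < 0 ∧ 0 < t₃
  · obtain ⟨ht₁, ht₃⟩ := hB
    obtain ⟨G, hG, h⟩ := exists_eightPartSD_of_counts (v := v) (T := T) false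
      (fun a => by have h := h₁ a; omega) (fun a => by have h := h₃ a; rw [Bool.not_false]; omega)
    exact ⟨G, hG, Or.inr (Or.inr (Or.inr ⟨false, h⟩))⟩
  -- a four part
  by_cases h1p : 0 < t₁
  · have ht₃ : 0 ≤ t₃ := by by_contra h; exact hA ⟨h1p, by omega⟩
    obtain ⟨G, hG, h⟩ := exists_fourPartSD_of_counts (v := v) (T := T) true (by omega) fun a => by have h := h₁ a; omega
    exact ⟨G, hG, Or.inr (Or.inl ⟨true, h⟩)⟩
  by_cases h1n : t₁ < 0
  · have ht₃ : t₃ ≤ 0 := by by_contra h; exact hB ⟨h1n, by omega⟩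
    obtain ⟨G, hG, h⟩ := exists_fourPartSD_of_counts (v := v) (T := T) false (by omega) fun a => by have h := h₁ a; omega
    exact ⟨G, hG, Or.inr (Or.inl ⟨false, h⟩)⟩
  have ht₁ : t₁ = 0 := by omega
  -- a six part
  by_cases h3p : 0 < t₃
  · obtain ⟨G, hG, h⟩ := exists_sixPartSD_of_counts (v := v) (T := T) true (by omega) fun a => by have h := h₃ a; omega
    exact ⟨G, hG, Or.inr (Or.inr (Or.inl ⟨true, h⟩))⟩
  by_cases h3n : t₃ < 0
  · obtain ⟨G, hG, h⟩ := exists_sixPartSD_of_counts (v := v) (T := T) false (by omega) fun a => by have h := h₃ a; omega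
    exact ⟨G, hG, Or.inr (Or.inr (Or.inl ⟨false, h⟩))⟩
  have ht₃ : t₃ = 0 := by omega
  -- all defects vanish: conjugation-invariant counts, a pair part
  subst ht₁ ht₃
  obtain ⟨x, hx⟩ := hne
  have hNx : 0 < (T.filter fun x' => v x' = v x).card := Finset.card_pos.2 ⟨x, Finset.mem_filter.2 ⟨hx, rfl⟩⟩
  have hNcx : 0 < (T.filter fun x' => v x' = cjSD (v x)).card := by
    rcases hvx : v x with s | ⟨⟨a, s⟩ | ⟨a, s⟩⟩ <;> rw [hvx] at hNx
    · cases s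
      · rw [cjSD_inl, Bool.not_false]; omega
      · rw [cjSD_inl, Bool.not_true]; omega
    · have h := h₁ a
      cases s
      · rw [cjSD_inr_inl, Bool.not_false]; omega
      · rw [cjSD_inr_inl, Bool.not_true]; omega
    · have h := h₃ a
      cases s
      · rw [cjSD_inr_inr, Bool.not_false]; omega
      · rw [cjSD_inr_inr, Bool.not_true]; omega
  obtain ⟨G, hG, hP'⟩ := exists_pairPartSD_of_counts (y := v x) hNx hNcx
  exact ⟨G, hG, Or.inl hP'⟩

include g hrot ht in
/-- **INDUCTION PRINCIPLE FOR BALANCED CONFIGURATIONS (any number of copies of `E, T, B`).**  If `motive` holds for `∅` and passes from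
`S` to `G ∪ S` for `G` disjoint from `S` a pair, four, six or eight part, then `motive` holds for every `R`-balanced configuration (`R`
rotation-stable on the decic pairs and transitive on the sextic pairs). [cite: Milne2020HodgeClassesAV, 1.2 (a) and Thm. 1]
[cite: GaoUllmo2025, Thm 3.1] -/
theorem modelBalancedSD_induction [DecidableEq α] {motive : Finset α → Prop} (h0 : motive ∅)
    (hpair : ∀ G S : Finset α, Disjoint G S → IsPairPartSD v G → motive S → motive (G ∪ S))
    (hfour : ∀ (G S : Finset α) (b : Bool), Disjoint G S → IsFourPartSD v b G → motive S → motive (G ∪ S))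
    (hsix : ∀ (G S : Finset α) (b : Bool), Disjoint G S → IsSixPartSD v b G → motive S → motive (G ∪ S))
    (height : ∀ (G S : Finset α) (b : Bool), Disjoint G S → IsEightPartSD v b G → motive S → motive (G ∪ S))
    {T : Finset α} (hT : ModelBalancedSD R v T) : motive T := by
  induction T using Finset.strongInduction with
  | H T ih =>
    by_cases hTe : T = ∅
    · subst hTe; exact h0
    obtain ⟨G, hGT, hG⟩ := exists_part_of_modelBalancedSD g hrot ht hT (Finset.nonempty_iff_ne_empty.2 hTe)
    have step : ModelBalancedSD R v G → G.Nonempty → (∀ S, Disjoint G S → motive S → motive (G ∪ S)) → motive T := by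
      intro hGb hGne hstep
      have hR : ModelBalancedSD R v (T \ G) := hT.sdiff hGb hGT
      have hlt : T \ G ⊂ T := Finset.sdiff_ssubset hGT hGne
      have h := hstep (T \ G) Finset.disjoint_sdiff (ih _ hlt hR)
      rwa [Finset.union_sdiff_of_subset hGT] at h
    rcases hG with hP | ⟨b, h4⟩ | ⟨b, h6⟩ | ⟨b, h8⟩
    · exact step (fun π _ => hP.balancedSD π) hP.nonempty fun S hd hm => hpair G S hd hP hm
    · exact step (fun π _ => h4.balancedSD π) h4.nonempty fun S hd hm => hfour G S b hd h4 hm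
    · exact step (fun π _ => h6.balancedSD π) h6.nonempty fun S hd hm => hsix G S b hd h6 hm
    · exact step (fun π _ => h8.balancedSD π) h8.nonempty fun S hd hm => height G S b hd h8 hm

end Extraction

end Summit.HodgeConjecture.CorCM.Census.SexticDecicWeil
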